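import Mathlib.Analysis.SpecialFunctions.Pow.Real
import HarnessLib

/-!
# Crux stmt-QuantumFields-19936 `UnitScaleTilt.HistoryTailL`, route crux `PoincareLipschitz.BlockLipschitzL` (stmt-QuantumFields-23533), K2 residue
# `hImprove` (v1, LEAD ★w1-19936 g9 RULING g9-3) decomposed by RULING g9-6 as `hImproveCore ∧ hLogFreeDecay`; the log-free one step is a TREE
# theorem (★w5-19936 g12 ✓p706915 `PoincareLipschitzSphereMapOneStepLogFree.oneStep_logFree`).  This file: **K-4 §1 — THE PURE-REAL DECAY
# ITERATION LETTER** every reduction `hImproveCore → hLogFreeDecay → ⟨hImprove v1⟩` needs, abstracted from all lattice objects.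

THE LOCATED POINT (w8 g7 memo `LOCATE-hImprove-roads-w8g7.md` §10, bus 07:47:54Z): `hImprove` v1's window `R/(C₀ log⁶R) ≤ r ≤ R/(κ log⁶R)`
with smallness `ε₀/log⁶r` is reachable from a first ABSOLUTELY small scale only if the normalised energy decays at RATE ≥ 1 below it (smallness
gain `F` at scale cost `≤ C·F`).  Reading the one step `E(Q_ρ) ≤ (A((ρ+1)/r)³ + ε)·E(Q_r) + 2·sl` at `ρ := r / M` with `M ≥ 64A`,
`ε ≤ (4M²)⁻¹` gives the SPECIALISED STEP `E(r/M) ≤ (2M²)⁻¹·E(r) + S`: the energy contracts by `2M²` while the scale contracts by at most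
`2M`, i.e. the normalised energy contracts by `M` per step — rate > 1.  Below, the iteration is carried out once and for all for an abstract
profile `E : ℤ → ℝ` along an abstract scale sequence `r : ℕ → ℤ` (the consumer takes `r j := r₀ / M^j`):

* §1 `decay_iterate` — threshold self-maintenance + geometric decay `E(r j) ≤ c^j·E(r 0) + Acc j` with STEP-DEPENDENT slacks `S j`
  (`2·S j ≤ ε₁·r (j+1)`, `Acc (j+1) = c·Acc j + S j`), `acc_le_geometric` (`S i ≤ D q^i`, `c ≤ q/2` ⇒ `Acc j ≤ 2D q^{j−1}`), and the
  uniform-slack corollary `decay_iterate_uniform` (`E(r j) ≤ c^j·E(r 0) + 2S₀`);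
* §2 `normalised_decay` — the normalised form `E(r j)/(r j) ≤ (cK)^j·(E(r 0)/(r 0)) + 2S/(r j)` (rate bookkeeping: with `c = (2M²)⁻¹`, `K = 2M`,
  `cK = M⁻¹` per step against a scale contraction `≤ 2M` — and `= M` up to rounding);
* §3 `exists_pow_between` — «scale loss ≤ linear in the smallness gain»: for `1 ≤ X`, `2 ≤ M` there is `j` with `X ≤ (2M)^j` and `M^j ≤ M·X`;
* §4 ℤ-division letters for the consumer's `r j := r₀ / M^j`: `r₀ / M^(j+1) = (r₀ / M^j) / M`, `(r : ℝ) ≤ 2M·↑(r / M)` for `2M ≤ r`,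
  `1 ≤ r / M` for `M ≤ r`, `r / M ≤ r`, and `↑(r/M) + 1 ≤ (2/M)·r` for `2M ≤ r` (the `(ρ+1)/r ≤ 2/M` row of the one step).

Cell `ym3-torus` (YM ladder rung R3 = continuum SU(2) Yang–Mills on T³ — a RUNG, NOT the Clay problem: not d = 4, not infinite volume, not a mass
gap); width seat `ym-ust-19936-w8` g7, helper `--supports stmt-QuantumFields-19936`; THEOREMS ONLY (0 `def`, 0 `sorry`, default heartbeats); pure
real/integer arithmetic, no lattice objects.
HONEST SCOPE.  Bookkeeping letters; nothing of `hImproveCore`, `hLogFreeDecay`, `hImprove`, `hRegH`, `BlockLipschitzL`, `HistoryTailL` or a summit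
statement is proved here.  [folklore]
-/

set_option autoImplicit false

noncomputable section

namespace Summit.QuantumFields.YangMills.Theorems.PoincareLipschitzKnitDecayIteration

/-! ## §1 Threshold self-maintenance and geometric decay along an abstract scale sequence -/

/-- ★★ **DECAY ITERATION (step-dependent slack).**  Let `E : ℤ → ℝ` be an energy profile, `r : ℕ → ℤ` a sequence of scales with `1 ≤ r j`
(`j ≤ J`) and `r j ≤ K·r (j+1)` as reals (`j < J`), a threshold `ε₁ > 0`, slacks `S j` with `2·S j ≤ ε₁·r (j+1)` (the slack of step `j` is
below half the threshold energy of the next scale), a contraction `0 ≤ c` with `c·K ≤ ½`, and the accumulated slack `Acc` defined by `Acc 0 = 0`,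
`Acc (j+1) = c·Acc j + S j`.  If the (specialised) one step `E (r j) ≤ ε₁·(r j) → E (r (j+1)) ≤ c·E (r j) + S j` holds for every `j < J` and
`E (r 0) ≤ ε₁·(r 0)`, then for every `j ≤ J`: `E (r j) ≤ ε₁·(r j)` (threshold SELF-MAINTAINED) and `E (r j) ≤ c^j·E (r 0) + Acc j`. [folklore] -/
theorem decay_iterate (E : ℤ → ℝ) (r : ℕ → ℤ) (S Acc : ℕ → ℝ) (J : ℕ) {ε₁ c K : ℝ}
    (hε₁ : 0 < ε₁) (hS : ∀ j, j < J → 2 * S j ≤ ε₁ * r (j + 1)) (hc0 : 0 ≤ c) (hcK : c * K ≤ 1 / 2)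
    (hAcc0 : Acc 0 = 0) (hAcc : ∀ j, Acc (j + 1) = c * Acc j + S j)
    (hr1 : ∀ j, j ≤ J → (1 : ℤ) ≤ r j)
    (hrK : ∀ j, j < J → (r j : ℝ) ≤ K * r (j + 1))
    (hstep : ∀ j, j < J → E (r j) ≤ ε₁ * r j → E (r (j + 1)) ≤ c * E (r j) + S j)
    (htop : E (r 0) ≤ ε₁ * r 0) :
    ∀ j, j ≤ J → E (r j) ≤ ε₁ * r j ∧ E (r j) ≤ c ^ j * E (r 0) + Acc j := by
  intro j hj
  induction j with
  | zero =>
    refine ⟨htop, ?_⟩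
    rw [hAcc0, pow_zero, one_mul, add_zero]
  | succ j ih =>
    have hjJ : j < J := Nat.lt_of_succ_le hj
    obtain ⟨ihT, ihD⟩ := ih (le_of_lt hjJ)
    have hst := hstep j hjJ ihT
    have hK := hrK j hjJ
    refine ⟨?_, ?_⟩
    · -- threshold: `E(r (j+1)) ≤ c·ε₁·r j + S j ≤ (cK)·ε₁·r(j+1) + S j ≤ ½ε₁ r(j+1) + ½ε₁ r(j+1)`
      have h1 : c * E (r j) ≤ c * (ε₁ * r j) := mul_le_mul_of_nonneg_left ihT hc0
      have h2 : c * (ε₁ * (r j : ℝ)) ≤ c * (ε₁ * (K * r (j + 1))) :=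
        mul_le_mul_of_nonneg_left (mul_le_mul_of_nonneg_left hK hε₁.le) hc0
      have h3 : c * (ε₁ * (K * (r (j + 1) : ℝ))) = (c * K) * (ε₁ * r (j + 1)) := by ring
      have hr1j : (1 : ℝ) ≤ (r (j + 1) : ℝ) := by exact_mod_cast hr1 (j + 1) hj
      have h4 : (c * K) * (ε₁ * (r (j + 1) : ℝ)) ≤ (1 / 2) * (ε₁ * r (j + 1)) :=
        mul_le_mul_of_nonneg_right hcK (by positivity)
      have h5 := hS j hjJ
      linarith
    · -- decay: `E(r (j+1)) ≤ c·(c^j E(r 0) + Acc j) + S j = c^{j+1} E(r 0) + Acc (j+1)`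
      have h1 : c * E (r j) ≤ c * (c ^ j * E (r 0) + Acc j) := mul_le_mul_of_nonneg_left ihD hc0
      have h2 : c * (c ^ j * E (r 0) + Acc j) + S j = c ^ (j + 1) * E (r 0) + Acc (j + 1) := by rw [hAcc j]; ring
      linarith

/-- ★ **ACCUMULATED SLACK UNDER GEOMETRIC DECAY OF THE STEP SLACKS.**  If `S i ≤ D·q^i` with `0 ≤ D`, `0 < q` and `c ≤ q/2`, `0 ≤ c`, then
`Acc j ≤ 2·D·q^j / q` for every `j` (so the accumulated slack is at most twice the LAST step's budget `D q^{j−1}` — the consumer's slacks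
`sl_r ∝ τ₀r²√ε₁ + τ₀²r³` shrink like `r_j² ≤ r₀²·M^{−2j}`, `q = M⁻²`, `c = (2M²)⁻¹ = q/2`). [folklore] -/
theorem acc_le_geometric (S Acc : ℕ → ℝ) {c q D : ℝ} (hc0 : 0 ≤ c) (hq : 0 < q) (hcq : c ≤ q / 2) (hD : 0 ≤ D)
    (hAcc0 : Acc 0 = 0) (hAcc : ∀ j, Acc (j + 1) = c * Acc j + S j) (hS : ∀ i, S i ≤ D * q ^ i) :
    ∀ j, Acc j ≤ 2 * D * q ^ j / q := by
  intro j
  induction j with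
  | zero => rw [hAcc0, pow_zero]; positivity
  | succ j ih =>
    rw [hAcc j, pow_succ]
    have h1 : c * Acc j ≤ (q / 2) * (2 * D * q ^ j / q) := by
      have hA : 0 ≤ 2 * D * q ^ j / q := by positivity
      calc c * Acc j ≤ c * (2 * D * q ^ j / q) := mul_le_mul_of_nonneg_left ih hc0
        _ ≤ (q / 2) * (2 * D * q ^ j / q) := mul_le_mul_of_nonneg_right hcq hA
    have e1 : (q / 2) * (2 * D * q ^ j / q) = D * q ^ j := by field_simp
    have e2 : 2 * D * (q ^ j * q) / q = 2 * (D * q ^ j) := by field_simp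
    rw [e2]
    linarith [hS j]

/-- The uniform-slack special case: `S j = S₀` with `2S₀ ≤ ε₁` and `c ≤ ½` gives `Acc j ≤ 2S₀`, hence `E (r j) ≤ c^j·E (r 0) + 2S₀`. [folklore] -/
theorem decay_iterate_uniform (E : ℤ → ℝ) (r : ℕ → ℤ) (J : ℕ) {ε₁ S₀ c K : ℝ}
    (hε₁ : 0 < ε₁) (hS0 : 0 ≤ S₀) (hS : 2 * S₀ ≤ ε₁) (hc0 : 0 ≤ c) (hc : c ≤ 1 / 2) (hcK : c * K ≤ 1 / 2)
    (hr1 : ∀ j, j ≤ J → (1 : ℤ) ≤ r j)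
    (hrK : ∀ j, j < J → (r j : ℝ) ≤ K * r (j + 1))
    (hstep : ∀ j, j < J → E (r j) ≤ ε₁ * r j → E (r (j + 1)) ≤ c * E (r j) + S₀)
    (htop : E (r 0) ≤ ε₁ * r 0) :
    ∀ j, j ≤ J → E (r j) ≤ ε₁ * r j ∧ E (r j) ≤ c ^ j * E (r 0) + 2 * S₀ := by
  -- accumulated slack `Acc j := Σ_{i<j} c^{j-1-i} S₀ ≤ 2 S₀`
  let Acc : ℕ → ℝ := fun j => Nat.rec 0 (fun _ a => c * a + S₀) j
  have hAcc0 : Acc 0 = 0 := rfl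
  have hAcc : ∀ j, Acc (j + 1) = c * Acc j + S₀ := fun j => rfl
  have hAccle : ∀ j, Acc j ≤ 2 * S₀ := by
    intro j
    induction j with
    | zero => rw [hAcc0]; linarith
    | succ j ih => rw [hAcc j]; nlinarith
  have hSj : ∀ j, j < J → 2 * S₀ ≤ ε₁ * (r (j + 1) : ℝ) := by
    intro j hj
    have : (1 : ℝ) ≤ (r (j + 1) : ℝ) := by exact_mod_cast hr1 (j + 1) hj
    nlinarith
  intro j hj
  obtain ⟨hT, hD⟩ := decay_iterate E r (fun _ => S₀) Acc J hε₁ hSj hc0 hcK hAcc0 hAcc hr1 hrK hstep htop j hj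
  exact ⟨hT, hD.trans (by linarith [hAccle j])⟩

/-! ## §2 The normalised form -/

/-- Scale comparison along the sequence: `r 0 ≤ K^j · r j` for `j ≤ J` (from `r i ≤ K·r (i+1)`, `0 ≤ K`). [folklore] -/
theorem scale_le_pow_mul (r : ℕ → ℤ) (J : ℕ) {K : ℝ} (hK0 : 0 ≤ K)
    (hrK : ∀ j, j < J → (r j : ℝ) ≤ K * r (j + 1)) :
    ∀ j, j ≤ J → (r 0 : ℝ) ≤ K ^ j * r j := by
  intro j hj
  induction j with
  | zero => simp
  | succ j ih =>
    have hjJ : j < J := Nat.lt_of_succ_le hj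
    have h1 := ih (le_of_lt hjJ)
    have h2 : K ^ j * (r j : ℝ) ≤ K ^ j * (K * r (j + 1)) := mul_le_mul_of_nonneg_left (hrK j hjJ) (pow_nonneg hK0 j)
    calc (r 0 : ℝ) ≤ K ^ j * r j := h1
      _ ≤ K ^ j * (K * r (j + 1)) := h2
      _ = K ^ (j + 1) * r (j + 1) := by ring

/-- ★★ **NORMALISED DECAY.**  Under the hypotheses of `decay_iterate` and `0 ≤ K`, `0 ≤ E (r 0)`, the normalised energy `φ j := E (r j)/(r j)`
obeys `φ j ≤ (c·K)^j · φ 0 + 2S/(r j)` for `j ≤ J`.  With the consumer's `c = (2M²)⁻¹`, `K = 2M` this is `φ j ≤ M^{−j}φ 0 + 2S/(r j)` while the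
true scale has contracted by `≍ M^j` — decay at rate ≥ 1. [folklore] -/
theorem normalised_decay (E : ℤ → ℝ) (r : ℕ → ℤ) (J : ℕ) {ε₁ S c K : ℝ}
    (hε₁ : 0 < ε₁) (hS0 : 0 ≤ S) (hS : 2 * S ≤ ε₁) (hc0 : 0 ≤ c) (hc : c ≤ 1 / 2) (hK0 : 0 ≤ K) (hcK : c * K ≤ 1 / 2)
    (hr1 : ∀ j, j ≤ J → (1 : ℤ) ≤ r j)
    (hrK : ∀ j, j < J → (r j : ℝ) ≤ K * r (j + 1))
    (hstep : ∀ j, j < J → E (r j) ≤ ε₁ * r j → E (r (j + 1)) ≤ c * E (r j) + S)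
    (hE0 : 0 ≤ E (r 0)) (htop : E (r 0) ≤ ε₁ * r 0) :
    ∀ j, j ≤ J → E (r j) / r j ≤ (c * K) ^ j * (E (r 0) / r 0) + 2 * S / r j := by
  intro j hj
  obtain ⟨_, hD⟩ := decay_iterate_uniform E r J hε₁ hS0 hS hc0 hc hcK hr1 hrK hstep htop j hj
  have hsc := scale_le_pow_mul r J hK0 hrK j hj
  have hrj : (0 : ℝ) < r j := by
    have : (1 : ℝ) ≤ (r j : ℝ) := by exact_mod_cast hr1 j hj
    linarith
  have hr0 : (0 : ℝ) < r 0 := by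
    have : (1 : ℝ) ≤ (r 0 : ℝ) := by exact_mod_cast hr1 0 (Nat.zero_le _)
    linarith
  -- `c^j E(r 0) / r j ≤ c^j E(r 0) · K^j / r 0 = (cK)^j (E (r 0)/ r 0)`
  have h1 : c ^ j * E (r 0) / r j ≤ (c * K) ^ j * (E (r 0) / r 0) := by
    rw [mul_pow, div_le_iff₀ hrj]
    have e : c ^ j * K ^ j * (E (r 0) / ↑(r 0)) * ↑(r j) = c ^ j * E (r 0) * (K ^ j * ↑(r j) / ↑(r 0)) := by
      field_simp
    rw [e]
    have h2 : (1 : ℝ) ≤ K ^ j * ↑(r j) / ↑(r 0) := by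
      rw [le_div_iff₀ hr0]; linarith
    have h3 : 0 ≤ c ^ j * E (r 0) := mul_nonneg (pow_nonneg hc0 j) hE0
    nlinarith
  calc E (r j) / r j ≤ (c ^ j * E (r 0) + 2 * S) / r j := div_le_div_of_nonneg_right hD hrj.le
    _ = c ^ j * E (r 0) / r j + 2 * S / r j := by rw [add_div]
    _ ≤ (c * K) ^ j * (E (r 0) / r 0) + 2 * S / r j := by linarith

/-! ## §3 Scale loss is at most linear in the smallness gain -/

/-- ★ **A POWER BETWEEN.**  For `1 ≤ X` and `2 ≤ M` there is `j : ℕ` with `X ≤ (2M)^j` and `M^j ≤ M·X`: the least number of steps achieving a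
smallness gain `X` at the normalised rate `2M` per step costs a scale factor `M^j ≤ M·X` — «scale loss ≤ linear in the gain», the arithmetic behind
`hImprove` v1's equal exponents (scale loss `C₀·log⁶R` for smallness `ε₀/log⁶r`). [folklore] -/
theorem exists_pow_between {X M : ℝ} (hX : 1 ≤ X) (hM : 2 ≤ M) :
    ∃ j : ℕ, X ≤ (2 * M) ^ j ∧ M ^ j ≤ M * X := by
  classical
  have hM0 : 0 < M := by linarith
  have h2M : 1 < 2 * M := by linarith
  -- the set of `j` with `X ≤ (2M)^j` is nonempty (Archimedes); take the least
  have hex : ∃ j : ℕ, X ≤ (2 * M) ^ j := by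
    obtain ⟨j, hj⟩ := pow_unbounded_of_one_lt X h2M
    exact ⟨j, hj.le⟩
  refine ⟨Nat.find hex, Nat.find_spec hex, ?_⟩
  set j := Nat.find hex with hjdef
  rcases Nat.eq_zero_or_pos j with h0 | hpos
  · rw [h0, pow_zero]
    nlinarith
  · -- minimality: `(2M)^(j-1) < X`, hence `M^j = M·M^(j-1) ≤ M·(2M)^(j-1) ≤ M·X`
    obtain ⟨k, hk⟩ : ∃ k, j = k + 1 := ⟨j - 1, by omega⟩
    have hmin : ¬ X ≤ (2 * M) ^ k := by
      have := Nat.find_min hex (show k < Nat.find hex by omega)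
      exact this
    push Not at hmin
    have hMk : M ^ k ≤ (2 * M) ^ k := pow_le_pow_left₀ hM0.le (by linarith) k
    rw [hk, pow_succ]
    calc M ^ k * M = M * M ^ k := by ring
      _ ≤ M * (2 * M) ^ k := mul_le_mul_of_nonneg_left hMk hM0.le
      _ ≤ M * X := mul_le_mul_of_nonneg_left hmin.le hM0.le

/-! ## §4 Integer-division letters for the scale sequence `r j := r₀ / M^j` -/

/-- `r₀ / M^(j+1) = (r₀ / M^j) / M` for `0 ≤ r₀`… in fact for all `r₀ : ℤ` and `M : ℕ` (ℤ-division by the positive naturals `M^j`, `M`). [folklore] -/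
theorem ediv_pow_succ (r₀ : ℤ) (M : ℕ) (j : ℕ) :
    r₀ / ((M : ℤ) ^ (j + 1)) = r₀ / ((M : ℤ) ^ j) / (M : ℤ) := by
  rw [pow_succ, Int.ediv_ediv_of_nonneg (pow_nonneg (Int.natCast_nonneg M) j)]

/-- `M · (r / M) ≥ r − (M − 1)` for `0 < M` (as integers). [folklore] -/
theorem mul_ediv_ge (r : ℤ) {M : ℤ} (hM : 0 < M) : r - (M - 1) ≤ M * (r / M) := by
  have h1 := Int.mul_ediv_add_emod r M
  have h2 := Int.emod_lt_of_pos r hM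
  linarith

/-- Positivity of the next scale: `1 ≤ r / M` once `M ≤ r` (`0 < M`). [folklore] -/
theorem one_le_ediv {r M : ℤ} (hM : 0 < M) (h : M ≤ r) : 1 ≤ r / M := by
  have := Int.le_ediv_of_mul_le hM (show 1 * M ≤ r by linarith)
  exact this

/-- The next scale does not exceed the current one: `r / M ≤ r` for `0 ≤ r`. [folklore] -/
theorem ediv_le_self' {r : ℤ} (M : ℤ) (hr : 0 ≤ r) : r / M ≤ r :=
  Int.ediv_le_self M hr

/-- ★ The scale row as reals: `(r : ℝ) ≤ 2M · ↑(r / M)` whenever `2(M − 1) ≤ r` (`0 < M`) — so the consumer's `K` is `2M`. [folklore] -/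
theorem cast_le_two_mul_cast_ediv {r M : ℤ} (hM : 0 < M) (h : 2 * (M - 1) ≤ r) :
    (r : ℝ) ≤ 2 * (M : ℝ) * ((r / M : ℤ) : ℝ) := by
  have h1 := mul_ediv_ge r hM
  -- `r − (M−1) ≤ M·(r/M)` and `M − 1 ≤ r/2`… combine: `r ≤ M (r/M) + (M−1) ≤ M(r/M) + r/2`? — instead use `r − (M−1) ≥ r/2`.
  have h2 : (r : ℝ) - ((M : ℝ) - 1) ≤ (M : ℝ) * ((r / M : ℤ) : ℝ) := by exact_mod_cast h1
  have h3 : (2 : ℝ) * ((M : ℝ) - 1) ≤ (r : ℝ) := by exact_mod_cast h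
  nlinarith

/-- ★ The `(ρ+1)/r ≤ 2/M` row of the one step at `ρ := r / M`: `(↑(r / M) + 1) ≤ (2 / M) · r` as reals, for `2M ≤ r` (`0 < M`). [folklore] -/
theorem cast_ediv_add_one_le {r M : ℤ} (hM : 0 < M) (h : 2 * M ≤ r) :
    ((r / M : ℤ) : ℝ) + 1 ≤ 2 / (M : ℝ) * (r : ℝ) := by
  have hM' : (0 : ℝ) < (M : ℝ) := by exact_mod_cast hM
  have h1 : M * (r / M) ≤ r := Int.mul_ediv_self_le (ne_of_gt hM)
  have h1' : (M : ℝ) * ((r / M : ℤ) : ℝ) ≤ (r : ℝ) := by exact_mod_cast h1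
  have h2 : (2 : ℝ) * (M : ℝ) ≤ (r : ℝ) := by exact_mod_cast h
  rw [div_mul_eq_mul_div, le_div_iff₀ hM']
  nlinarith

/-! ## §5 (v1.2 append) The Morrey-class slack: `S j ≤ σ·r (j+1)` ⟹ accumulated slack `≤ 2σ·r j` -/

/-- Reverse scale comparison along the sequence: `r i ≤ K^(j−i)·r j` for `i ≤ j ≤ J`, stated as `r (j − n) ≤ K^n · r j`… we only need the
one-index form `r (i+1) ≤ K^(j-1-i) · r j` for `i < j`, proved here as `∀ n i, i + n ≤ J → ↑(r i) ≤ K^n · ↑(r (i + n))`. [folklore] -/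
theorem scale_le_pow_mul' (r : ℕ → ℤ) (J : ℕ) {K : ℝ} (hK0 : 0 ≤ K)
    (hrK : ∀ j, j < J → (r j : ℝ) ≤ K * r (j + 1)) :
    ∀ n i, i + n ≤ J → (r i : ℝ) ≤ K ^ n * r (i + n) := by
  intro n
  induction n with
  | zero => intro i _; simp
  | succ n ih =>
    intro i hi
    have h1 := ih i (by omega)
    have h2 : (r (i + n) : ℝ) ≤ K * r (i + n + 1) := hrK (i + n) (by omega)
    have h3 : K ^ n * (r (i + n) : ℝ) ≤ K ^ n * (K * r (i + n + 1)) := mul_le_mul_of_nonneg_left h2 (pow_nonneg hK0 n)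
    calc (r i : ℝ) ≤ K ^ n * r (i + n) := h1
      _ ≤ K ^ n * (K * r (i + n + 1)) := h3
      _ = K ^ (n + 1) * r (i + (n + 1)) := by rw [show i + (n + 1) = i + n + 1 by omega]; ring

/-- ★ **ACCUMULATED SLACK IN THE MORREY CLASS.**  If the step slacks satisfy `S i ≤ σ·r (i+1)` (`i < J`, `0 ≤ σ`) — the twist source of the
log-free one step is of this class: `sl_r ∝ τ₀√ε₁·r² + τ₀²r³ = (τ₀r√ε₁ + τ₀²r²)·r` with `τ₀r ≤ τ₀R ≤ C₀⁻¹` — and `0 ≤ c`, `c·K ≤ ½`,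
`r i ≤ K·r (i+1)`, then the accumulated slack of `decay_iterate` obeys `Acc j ≤ 2σ·r j` for all `j ≤ J`: the slack floor is LINEAR IN THE CURRENT
SCALE, i.e. the normalised slack `Acc j / r j ≤ 2σ` is scale-free (and log-small once `σ` is, ★w2-19936 g12 08:06:16Z). [folklore] -/
theorem acc_le_linear (r : ℕ → ℤ) (S Acc : ℕ → ℝ) (J : ℕ) {c K σ : ℝ}
    (hc0 : 0 ≤ c) (hcK : c * K ≤ 1 / 2) (hσ : 0 ≤ σ)
    (hr0 : ∀ j, j ≤ J → (0 : ℝ) ≤ r j)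
    (hrK : ∀ j, j < J → (r j : ℝ) ≤ K * r (j + 1))
    (hAcc0 : Acc 0 = 0) (hAcc : ∀ j, Acc (j + 1) = c * Acc j + S j)
    (hS : ∀ i, i < J → S i ≤ σ * r (i + 1)) :
    ∀ j, j ≤ J → Acc j ≤ 2 * σ * r j := by
  intro j hj
  induction j with
  | zero => rw [hAcc0]; have := hr0 0 hj; positivity
  | succ j ih =>
    have hjJ : j < J := Nat.lt_of_succ_le hj
    rw [hAcc j]
    have h1 := ih (le_of_lt hjJ)
    have h2 := hS j hjJ
    have h3 := hrK j hjJ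
    have h4 : c * Acc j ≤ c * (2 * σ * r j) := mul_le_mul_of_nonneg_left h1 hc0
    have h5 : c * (2 * σ * (r j : ℝ)) ≤ c * (2 * σ * (K * r (j + 1))) :=
      mul_le_mul_of_nonneg_left (mul_le_mul_of_nonneg_left h3 (by positivity)) hc0
    have h6 : c * (2 * σ * (K * (r (j + 1) : ℝ))) = 2 * (c * K) * (σ * r (j + 1)) := by ring
    have h7 : 2 * (c * K) * (σ * (r (j + 1) : ℝ)) ≤ 2 * (1 / 2) * (σ * r (j + 1)) := by
      have : 0 ≤ σ * (r (j + 1) : ℝ) := mul_nonneg hσ (hr0 (j + 1) hj)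
      nlinarith
    linarith

/-- ★★ **DECAY ITERATION WITH A MORREY-CLASS SOURCE** (packaged for the K-4 knit).  Under `decay_iterate`'s hypotheses with slacks
`S j ≤ σ·r (j+1)` and `2σ ≤ ε₁/2`… precisely `4σ ≤ ε₁` (so that `2·S j ≤ ε₁·r (j+1)` holds automatically), for every `j ≤ J`:
`E (r j) ≤ ε₁·r j` and `E (r j) ≤ c^j·E (r 0) + 2σ·r j` — hence, with `r 0 ≤ K^j·r j` (`scale_le_pow_mul`), the normalised energy obeys
`E (r j)/r j ≤ (cK)^j·E (r 0)/r 0 + 2σ`. [folklore] -/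
theorem decay_iterate_src (E : ℤ → ℝ) (r : ℕ → ℤ) (S : ℕ → ℝ) (J : ℕ) {ε₁ c K σ : ℝ}
    (hε₁ : 0 < ε₁) (hc0 : 0 ≤ c) (hcK : c * K ≤ 1 / 2) (hσ : 0 ≤ σ) (hσε : 4 * σ ≤ ε₁)
    (hr1 : ∀ j, j ≤ J → (1 : ℤ) ≤ r j)
    (hrK : ∀ j, j < J → (r j : ℝ) ≤ K * r (j + 1))
    (hS : ∀ i, i < J → S i ≤ σ * r (i + 1))
    (hstep : ∀ j, j < J → E (r j) ≤ ε₁ * r j → E (r (j + 1)) ≤ c * E (r j) + S j)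
    (htop : E (r 0) ≤ ε₁ * r 0) :
    ∀ j, j ≤ J → E (r j) ≤ ε₁ * r j ∧ E (r j) ≤ c ^ j * E (r 0) + 2 * σ * r j := by
  let Acc : ℕ → ℝ := fun j => Nat.rec 0 (fun i a => c * a + S i) j
  have hAcc0 : Acc 0 = 0 := rfl
  have hAcc : ∀ j, Acc (j + 1) = c * Acc j + S j := fun j => rfl
  have hr0 : ∀ j, j ≤ J → (0 : ℝ) ≤ r j := by
    intro j hj; have : (1 : ℝ) ≤ (r j : ℝ) := by exact_mod_cast hr1 j hj
    linarith
  have hS2 : ∀ j, j < J → 2 * S j ≤ ε₁ * (r (j + 1) : ℝ) := by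
    intro j hj
    have h1 := hS j hj
    have h2 := hr0 (j + 1) hj
    nlinarith
  intro j hj
  obtain ⟨hT, hD⟩ := decay_iterate E r S Acc J hε₁ hS2 hc0 hcK hAcc0 hAcc hr1 hrK hstep htop j hj
  have hA := acc_le_linear r S Acc J hc0 hcK hσ hr0 hrK hAcc0 hAcc hS j hj
  exact ⟨hT, by linarith⟩

end Summit.QuantumFields.YangMills.Theorems.PoincareLipschitzKnitDecayIteration

end
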